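import Summits.CriticalPhenomena.SAWScalingLimit.Theorems.SAWWeldingIdentificationRemovableLimitIdle
import Literature.Probability.RandomPlanarGeometry.SLEExistenceNeEightHolds
import HarnessLib

/-!
# Route `SAWWeldingIdentification` without the crux `RemovableLimit` — paste-ready restructure

Companion of `SAWWeldingIdentificationRemovableLimitIdle.lean` (lead c2 of crux
stmt-CriticalPhenomena-4503), which proves that the route's deciding chain closes from
`WeldingLawOfLimit ∧ EventualTight` alone (`sawScalingLimit_of_weldingLawOfLimit_of_eventualTight`:
one-sided welding rigidity + identification by disintegration). That certificate cannot be pasted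
into the Theses file (its proof imports Theorems modules that import the Theses file). This file
supplies the planner with the two pieces of a ROUTE EDIT that removes stmt-4503 from the item graph
while keeping the deciding theorem self-contained:

* `identifyFromWeldingOneSided_item` — the statement (over Literature vocabulary only, all clauses
  inlined as in the current items) of a new support item `IdentifyFromWeldingOneSided`, PROVED: the
  Lusin–Souslin item `IdentifyFromWelding` (stmt-4507) with the removability hypothesis on the
  `P`-side dropped and the separation hypothesis made one-sided;
* `closes_with_simpleSubseqLimits` — the deciding theorem with hypotheses = the route's items where
  `RemovableLimit` is replaced by the SHARED crux `SimpleSubseqLimits` (stmt-4982, `D`-form,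
  verbatim) and `IdentifyFromWelding` by the one-sided support; its proof uses only the hypotheses,
  Mathlib and `Literature`, so it elaborates verbatim as a Theses-file `closes`;
* `sawScalingLimit_of_three_cruxes : WeldingLawOfLimit → SimpleSubseqLimits → EventualTight →
  SAWScalingLimit` — all supports of the restructured route discharged.

Remark for the planner: `SimpleSubseqLimits` at `D := Q.chord 0 2` is itself implied by
`WeldingLawOfLimit` as typed (`WeldingLawOfLimit.ae_isSimpleChord_of_weldingLawOfLimit`), so the
honest open content of the route is stmt-4502 ∧ stmt-1372 (and stmt-4502 ⟺ stmt-0783,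
`weldingLawOfLimit_iff_subseqIdentification`); listing stmt-4982 keeps the simplicity mechanism
visible but adds no obligation.
-/

noncomputable section

open MeasureTheory ProbabilityTheory Filter Topology Set
open scoped ENNReal NNReal
open Literature.Probability.RandomPlanarGeometry Literature.Probability.LatticeModels
open Literature.Probability.Process (preWienerMeasure)
open UpperHalfPlane (upperHalfPlaneSet)
open Summit.CriticalPhenomena.SAWScalingLimit.Theses

namespace Summit.CriticalPhenomena.SAWScalingLimit.Theorems.RemovableLimit

/-- **Support item `IdentifyFromWeldingOneSided` (proposed; statement over Literature vocabulary,
PROVED).** For a conformal rectangle `Q`, a welding functional `W` Borel in the chord, a probability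
measure `P` on `CurveClass ℂ` and an a.e.-measurable random curve `Γ` on the Wiener space: if
`P`-a.e. curve is a SIMPLE CHORD of `(Ω; a, b) = Q.chord 0 2` (no removability asked of `P`),
a.e. `Γ ω` is a conformally removable simple chord, the welding at positive rationals separates
every removable simple chord from every simple chord, and all finite-dimensional `W`-marginals of
`P` and `ℙ ∘ Γ⁻¹` at positive rational points agree, then `P = ℙ ∘ Γ⁻¹`. One line from
`identifyFromWelding_oneSided`. [folklore] -/
theorem identifyFromWeldingOneSided_item :
    ∀ (Q : ConformalRectangle) (W : ConformalRectangle → CurveClass ℂ → ℝ → ℝ)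
      (P : Measure (CurveClass ℂ)) (Γ : (NNReal → ℝ) → CurveClass ℂ),
      IsProbabilityMeasure P → IsProbabilityMeasure (preWienerMeasure.map Γ) →
      AEMeasurable Γ preWienerMeasure →
      (∀ (Q : ConformalRectangle) (x : ℝ), Measurable fun γ : CurveClass ℂ => W Q γ x) →
      (∀ᵐ γ ∂P, (γ ∈ CurveClass.simple ∧ γ.source = Q.pt 0 ∧ γ.target = Q.pt 2 ∧
        γ.range ⊆ closure Q.carrier ∧ γ.range ∩ frontier Q.carrier ⊆ {Q.pt 0, Q.pt 2})) →
      (∀ᵐ ω ∂preWienerMeasure, ((Γ ω) ∈ CurveClass.simple ∧ (Γ ω).source = Q.pt 0 ∧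
          (Γ ω).target = Q.pt 2 ∧ (Γ ω).range ⊆ closure Q.carrier ∧
          (Γ ω).range ∩ frontier Q.carrier ⊆ {Q.pt 0, Q.pt 2}) ∧
        (∀ F : ℂ → ℂ, ContinuousOn F Q.carrier → Set.InjOn F Q.carrier → F '' Q.carrier = Q.carrier →
          DifferentiableOn ℂ F (Q.carrier \ (Γ ω).range) → DifferentiableOn ℂ F Q.carrier)) →
      (∀ γ γ' : CurveClass ℂ,
        ((γ ∈ CurveClass.simple ∧ γ.source = Q.pt 0 ∧ γ.target = Q.pt 2 ∧
            γ.range ⊆ closure Q.carrier ∧ γ.range ∩ frontier Q.carrier ⊆ {Q.pt 0, Q.pt 2}) ∧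
          (∀ F : ℂ → ℂ, ContinuousOn F Q.carrier → Set.InjOn F Q.carrier →
            F '' Q.carrier = Q.carrier → DifferentiableOn ℂ F (Q.carrier \ γ.range) →
            DifferentiableOn ℂ F Q.carrier)) →
        (γ' ∈ CurveClass.simple ∧ γ'.source = Q.pt 0 ∧ γ'.target = Q.pt 2 ∧
          γ'.range ⊆ closure Q.carrier ∧ γ'.range ∩ frontier Q.carrier ⊆ {Q.pt 0, Q.pt 2}) →
        (∀ q : ℚ, 0 < q → W Q γ q = W Q γ' q) → γ = γ') →
      (∀ (k : ℕ) (x : Fin k → ℚ), (∀ i, 0 < x i) →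
        P.map (fun γ i => W Q γ (x i)) = (preWienerMeasure.map Γ).map (fun γ i => W Q γ (x i))) →
      P = preWienerMeasure.map Γ := by
  intro Q W P Γ hP hμ hΓ hWmeas hPae hμae hrig hmarg
  haveI : IsProbabilityMeasure preWienerMeasure :=
    Literature.Probability.RandomPlanarGeometry.isProbabilityMeasure_preWienerMeasure'
  exact identifyFromWelding_oneSided Q W P preWienerMeasure Γ hΓ (hWmeas Q) hPae
    (fun γ => (γ ∈ CurveClass.simple ∧ γ.source = Q.pt 0 ∧ γ.target = Q.pt 2 ∧
        γ.range ⊆ closure Q.carrier ∧ γ.range ∩ frontier Q.carrier ⊆ {Q.pt 0, Q.pt 2}) ∧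
      (∀ F : ℂ → ℂ, ContinuousOn F Q.carrier → Set.InjOn F Q.carrier → F '' Q.carrier = Q.carrier →
        DifferentiableOn ℂ F (Q.carrier \ γ.range) → DifferentiableOn ℂ F Q.carrier))
    hμae (fun γ hγ => hγ.1) (fun γ γ' hγ hγ' h => hrig γ γ' hγ hγ' h) hmarg

/-- **Deciding theorem of the restructured route (paste-ready).** Hypotheses = the items of route
`SAWWeldingIdentification` with the crux `RemovableLimit` (stmt-4503) REPLACED by the shared crux
`SimpleSubseqLimits` (stmt-4982, verbatim `D`-form) and the support `IdentifyFromWelding` replaced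
by the one-sided support (type of `identifyFromWeldingOneSided_item`); conclusion = the sub-problem
statement. The proof uses only the hypotheses, Mathlib and `Literature` (`IsSLECurve.map_eq_holds`,
`isProbabilityMeasure_preWienerMeasure'`, `SAW.aemeasurable_curve`), exactly like the current
`closes`, so a planner can paste it as the new deciding theorem. Steps: complete `D` to a conformal
rectangle `Q`; SLE curve `Γ`, `μ = ℙ ∘ Γ⁻¹`; for a subsequential limit `P`: chord support from
stmt-4982 at `D := Q.chord 0 2` (positive `δₙ → 0` is `δₙ → 0⁺`), SLE side from `SLERemovableChord`,
ONE-SIDED separation from `WeldingSetup` + `WeldingRigidity` (only `γ` removable), marginals from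
`WeldingLawOfLimit`; `LimitUpgrade` with `EventualTight`; `integral_map`. [folklore] -/
theorem closes_with_simpleSubseqLimits
    (hW : SAWWeldingIdentification.WeldingLawOfLimit) (hS1 : SAWLoopFugacityFlow.SimpleSubseqLimits)
    (hT : SAWWeldingIdentification.EventualTight) (hS : SAWWeldingIdentification.WeldingSetup)
    (hRig : SAWWeldingIdentification.WeldingRigidity) (hC : SAWWeldingIdentification.SLERemovableChord)
    (hI : ∀ (Q : ConformalRectangle) (W : ConformalRectangle → CurveClass ℂ → ℝ → ℝ)
      (P : Measure (CurveClass ℂ)) (Γ : (NNReal → ℝ) → CurveClass ℂ),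
      IsProbabilityMeasure P → IsProbabilityMeasure (preWienerMeasure.map Γ) →
      AEMeasurable Γ preWienerMeasure →
      (∀ (Q : ConformalRectangle) (x : ℝ), Measurable fun γ : CurveClass ℂ => W Q γ x) →
      (∀ᵐ γ ∂P, (γ ∈ CurveClass.simple ∧ γ.source = Q.pt 0 ∧ γ.target = Q.pt 2 ∧
        γ.range ⊆ closure Q.carrier ∧ γ.range ∩ frontier Q.carrier ⊆ {Q.pt 0, Q.pt 2})) →
      (∀ᵐ ω ∂preWienerMeasure, ((Γ ω) ∈ CurveClass.simple ∧ (Γ ω).source = Q.pt 0 ∧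
          (Γ ω).target = Q.pt 2 ∧ (Γ ω).range ⊆ closure Q.carrier ∧
          (Γ ω).range ∩ frontier Q.carrier ⊆ {Q.pt 0, Q.pt 2}) ∧
        (∀ F : ℂ → ℂ, ContinuousOn F Q.carrier → Set.InjOn F Q.carrier → F '' Q.carrier = Q.carrier →
          DifferentiableOn ℂ F (Q.carrier \ (Γ ω).range) → DifferentiableOn ℂ F Q.carrier)) →
      (∀ γ γ' : CurveClass ℂ,
        ((γ ∈ CurveClass.simple ∧ γ.source = Q.pt 0 ∧ γ.target = Q.pt 2 ∧
            γ.range ⊆ closure Q.carrier ∧ γ.range ∩ frontier Q.carrier ⊆ {Q.pt 0, Q.pt 2}) ∧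
          (∀ F : ℂ → ℂ, ContinuousOn F Q.carrier → Set.InjOn F Q.carrier →
            F '' Q.carrier = Q.carrier → DifferentiableOn ℂ F (Q.carrier \ γ.range) →
            DifferentiableOn ℂ F Q.carrier)) →
        (γ' ∈ CurveClass.simple ∧ γ'.source = Q.pt 0 ∧ γ'.target = Q.pt 2 ∧
          γ'.range ⊆ closure Q.carrier ∧ γ'.range ∩ frontier Q.carrier ⊆ {Q.pt 0, Q.pt 2}) →
        (∀ q : ℚ, 0 < q → W Q γ q = W Q γ' q) → γ = γ') →
      (∀ (k : ℕ) (x : Fin k → ℚ), (∀ i, 0 < x i) →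
        P.map (fun γ i => W Q γ (x i)) = (preWienerMeasure.map Γ).map (fun γ i => W Q γ (x i))) →
      P = preWienerMeasure.map Γ)
    (hL : SAWWeldingIdentification.LimitUpgrade) (hE : SAWWeldingIdentification.ChordalSLE83Exists) :
    _root_.SAWScalingLimit := by
  -- adapted from `Summit.CriticalPhenomena.SAWScalingLimit.Theses.SAWWeldingIdentification.closes`
  intro D a b hab
  -- Step 0. Complete `D = (Ω; a, b)` to a conformal rectangle `Q` with `Q.chord 0 2 = D`.
  obtain ⟨Q, rfl⟩ : ∃ Q : ConformalRectangle, Q.chord 0 2 (by decide) = D := by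
    obtain ⟨J, m, hm, hmem⟩ := D
    have h01 : m 0 < m 1 := hm (show (0 : Fin 2) < 1 by decide)
    have h0 : 0 ≤ m 0 ∧ m 0 < 1 := hmem 0
    have h1 : 0 ≤ m 1 ∧ m 1 < 1 := hmem 1
    refine ⟨⟨J, ![m 0, (m 0 + m 1) / 2, m 1, (m 1 + 1) / 2], ?_, ?_⟩, ?_⟩
    · refine Fin.strictMono_iff_lt_succ.2 fun k => ?_
      fin_cases k
      · show m 0 < (m 0 + m 1) / 2
        linarith
      · show (m 0 + m 1) / 2 < m 1
        linarith
      · show m 1 < (m 1 + 1) / 2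
        linarith
    · intro k
      fin_cases k
      · show m 0 ∈ Set.Ico (0 : ℝ) 1
        exact hmem 0
      · show (m 0 + m 1) / 2 ∈ Set.Ico (0 : ℝ) 1
        exact ⟨by linarith, by linarith⟩
      · show m 1 ∈ Set.Ico (0 : ℝ) 1
        exact hmem 1
      · show (m 1 + 1) / 2 ∈ Set.Ico (0 : ℝ) 1
        exact ⟨by linarith, by linarith⟩
    · simp only [Literature.Probability.RandomPlanarGeometry.MarkedDomain.chord]
      congr 1
      funext k
      fin_cases k <;> rfl
  -- Step 1. The chordal SLE_{8/3} random curve `Γ` in `D` and its law `μ = ℙ ∘ Γ⁻¹`.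
  obtain ⟨Γ, hΓ⟩ := hE (Q.chord 0 2 (by decide))
  haveI : IsProbabilityMeasure preWienerMeasure :=
    Literature.Probability.RandomPlanarGeometry.isProbabilityMeasure_preWienerMeasure'
  have hΓm : AEMeasurable Γ preWienerMeasure := hΓ.1
  have hμ : IsProbabilityMeasure (preWienerMeasure.map Γ) := Measure.isProbabilityMeasure_map hΓm
  -- Step 2. Eventual tightness + "every subsequential weak limit is `μ`" ⇒ convergence in law.
  have hconv : TendstoLaw
      (fun δ (γ : SAW.DomainSAW (Q.chord 0 2 (by decide)).carrier δ (a δ) (b δ)) => γ.curve)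
      (fun δ => SAW.law (Q.chord 0 2 (by decide)).carrier δ (a δ) (b δ))
      id (preWienerMeasure.map Γ) := by
    refine hL (Q.chord 0 2 (by decide)) a b hab (hT _ a b hab) _ hμ ?_
    intro P hP δs hpos hδ hlim
    obtain ⟨hsign, W, hWmeas, hWpin⟩ := hS
    obtain ⟨s, hs, hconf⟩ := hsign Q
    refine hI Q W P Γ hP hμ hΓm hWmeas ?_ ?_ ?_ ?_
    · -- `P`-a.s. the limit curve is a simple chord: stmt-4982 at `D := Q.chord 0 2`
      have hδ' : Tendsto δs atTop (𝓝[>] (0 : ℝ)) :=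
        tendsto_nhdsWithin_iff.2 ⟨hδ, Eventually.of_forall hpos⟩
      exact hS1 (Q.chord 0 2 (by decide)) a b hab δs P hδ' hP hlim
    · -- a.s. the SLE_{8/3} curve is a removable simple chord
      exact hC Q Γ hΓ
    · -- ONE-SIDED separation: a removable chord vs ANY simple chord with the same welding
      intro γ γ' hγ hγ' heq
      obtain ⟨L, R, φ, ψ, hb, hn⟩ := hconf γ hγ.1
      obtain ⟨L', R', φ', ψ', hb', hn'⟩ := hconf γ' hγ'
      refine hRig Q γ γ' s L R L' R' φ ψ φ' ψ' (fun q => W Q γ q) hγ.1 hγ' hγ.2 hs hb hb' hn hn' ?_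
      intro q hq
      have hq' : (0 : ℝ) < (q : ℝ) := by exact_mod_cast hq
      obtain ⟨hpos₁, hw₁⟩ := hWpin Q γ s L R φ ψ hγ.1 hs hb hn q hq'
      obtain ⟨-, hw₂⟩ := hWpin Q γ' s L' R' φ' ψ' hγ' hs hb' hn' q hq'
      refine ⟨hpos₁, hw₁, ?_⟩
      rw [heq q hq]
      exact hw₂
    · -- the welding laws agree (W), at positive rational points
      intro k x hx
      exact hW IsSLECurve.map_eq_holds W hWpin hWmeas Q a b hab P hP δs hpos hδ hlim Γ hΓ k
        (fun i => (x i : ℝ)) (fun i => by exact_mod_cast hx i)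
  -- Step 3. Convergence in law to `μ = ℙ ∘ Γ⁻¹` is convergence in law to the random curve `Γ`.
  refine ⟨Γ, hΓ, Filter.Eventually.of_forall fun δ => SAW.aemeasurable_curve _ _ _ _, fun f => ?_⟩
  have h := hconv f
  simp only [id] at h
  rw [MeasureTheory.integral_map hΓm f.continuous.aestronglyMeasurable] at h
  exact h

/-- **The restructured route's only new obligation is already discharged**: with the one-sided
support proved (`identifyFromWeldingOneSided_item`) and the other supports proved in tree, the
restructured deciding theorem reduces the conjunct to `WeldingLawOfLimit ∧ SimpleSubseqLimits ∧
EventualTight` — and the middle one is implied by the first (`isSLELaw_of_weldingLawOfLimit`), cf.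
`sawScalingLimit_of_weldingLawOfLimit_of_eventualTight`. [folklore] -/
theorem sawScalingLimit_of_three_cruxes :
    Summit.CriticalPhenomena.SAWScalingLimit.Theses.SAWWeldingIdentification.WeldingLawOfLimit →
      Summit.CriticalPhenomena.SAWScalingLimit.Theses.SAWLoopFugacityFlow.SimpleSubseqLimits →
      Summit.CriticalPhenomena.SAWScalingLimit.Theses.SAWWeldingIdentification.EventualTight →
      _root_.SAWScalingLimit :=
  fun hW hS1 hT => closes_with_simpleSubseqLimits hW hS1 hT WeldingSetup_proof
    WeldingRigidity.weldingRigidity_proof SLERemovableChord_proof identifyFromWeldingOneSided_item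
    limitUpgrade_proof
    -- buildfix 2026-08-20 (proof only): the route's gate link `ChordalSLE83Exists_holds` is no longer
    -- rendered; the item is the κ = 8/3 instance of the Literature existence theorem, used directly.
    (fun D => Literature.Probability.RandomPlanarGeometry.exists_isSLECurve_eightThirds D)

end Summit.CriticalPhenomena.SAWScalingLimit.Theorems.RemovableLimit

end
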